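import Mathlib
import HarnessLib

/-!
# Pock–Chambolle diagonal preconditioning: the `α`-family of diagonal step sizes makes the
# rescaled coupling matrix a contraction (Pock–Chambolle, ICCV 2011, Lemma 2)

Topic `Literature/Analysis/Convex` (companion of `PrimalDualHybridGradient.lean`, whose convergence
theorems ask for step sizes with `τσ‖K‖² < 1`, resp. `≤ 1` for the ergodic rate). Preconditioned PDHG
replaces the scalar steps by diagonal matrices `T = diag(τ_j)`, `Σ = diag(σ_i)`; it is plain PDHG with
unit steps on the rescaled matrix `Σ^{1/2} K T^{1/2}`, so what has to be checked is
`‖Σ^{1/2} K T^{1/2}‖ ≤ 1`. Pock and Chambolle's family [PockChambolle2011, §2, eq. (10) and Lemma 2]: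
for `α ∈ [0, 2]`,
`τ_j = 1 / Σ_i |K_ij|^{2−α}`, `σ_i = 1 / Σ_j |K_ij|^α  ⟹  ‖Σ^{1/2} K T^{1/2}‖ ≤ 1`
(one line of Cauchy–Schwarz). The primary text (ICCV proceedings) is not held; the statement is
vendored from the restatement in [MaEtAl2023, Proposition 2 and its proof: «By [PC11], we know
‖(M₂/γ₂)^{−1/2} K (M₁/γ₁)^{−1/2}‖ ≤ 1», with M₁ = diag(δ + Σ_i |K_ij|^{2−α}), M₂ = diag(δ + Σ_j |K_ij|^α),
δ ≥ 0; Remark 5: γ₁ = γ₂ = 1 is [PC11]] and proved here. `α = 1` (column and row `ℓ¹` norms) is the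
default "Pock–Chambolle rescaling" of PDLP-type LP/conic codes.

We state the lemma in its basis-free meaning, which needs no matrix square roots:
`⟨y, K x⟩² ≤ (Σ_i σ̂_i y_i²) · (Σ_j τ̂_j x_j²)` with the WEIGHTS (inverse steps)
`σ̂_i = δ + Σ_j |K_ij|^α`, `τ̂_j = δ + Σ_i |K_ij|^{2−α}` — i.e. `|⟨y, Kx⟩| ≤ ‖y‖_{M₂} ‖x‖_{M₁}`, which is
`‖M₂^{−1/2} K M₁^{−1/2}‖ ≤ 1` whenever the weights are positive — and derive the squared-norm form
`‖K̃ x‖₂² ≤ ‖x‖₂²` for the rescaled matrix `K̃_ij = K_ij / (√σ̂_i √τ̂_j)`.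

* `rowWeight K α δ i = δ + Σ_j |K_ij|^α` (`= 1/σ_i`), `colWeight K α δ j = δ + Σ_i |K_ij|^{2−α}` (`= 1/τ_j`);
* **`dotProduct_mulVec_sq_le`** — the weighted Cauchy–Schwarz inequality above (any real `α`, `δ ≥ 0`;
  zero rows/columns allowed);
* `rowWeight_one`, `colWeight_one`, `dotProduct_mulVec_sq_le_one` — the `α = 1` (ℓ¹) instance;
* `rescaled`, `dotProduct_rescaled_mulVec_sq_le`, **`sum_sq_rescaled_mulVec_le`** — `⟨v, K̃x⟩² ≤ ‖v‖²‖x‖²`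
  and `‖K̃ x‖² ≤ ‖x‖²` for positive weights; `rescaledCLM`, **`norm_rescaledCLM_le_one`** — the same
  as an operator-norm bound `‖K̃‖ ≤ 1` between Euclidean spaces (what the PDHG theorems consume).

Deliberately NOT here: the convergence theorem of preconditioned PDHG itself ([PockChambolle2011,
Thm 1] / [MaEtAl2023, §2]) — for diagonal `T, Σ` it is `PrimalDualHybridGradient.tendsto_pdhgIter`
applied to `K̃` with unit steps after the change of variables `x ↦ T^{−1/2}x`, `y ↦ Σ^{−1/2}y`, which
we do not spell out; Ruiz equilibration; the sharpened condition `γ₁γ₂ > 3/4` of [MaEtAl2023, Prop 2].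
-/

namespace Literature.Analysis.Convex.DiagonalPreconditioningPDHG

open Matrix Finset

variable {m n : Type*} [Fintype m] [Fintype n]

/-- The dual-side weight (inverse dual step) of row `i`: `σ̂_i = δ + Σ_j |K_ij|^α`.
[cite: MaEtAl2023, Proposition 2 (M₂)] [cite: PockChambolle2011, §2 eq. (10) (σ_i = 1/Σ_j |K_ij|^α)] -/
noncomputable def rowWeight (K : Matrix m n ℝ) (α δ : ℝ) (i : m) : ℝ :=
  δ + ∑ j, |K i j| ^ α

/-- The primal-side weight (inverse primal step) of column `j`: `τ̂_j = δ + Σ_i |K_ij|^{2−α}`.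
[cite: MaEtAl2023, Proposition 2 (M₁)] [cite: PockChambolle2011, §2 eq. (10) (τ_j = 1/Σ_i |K_ij|^{2−α})] -/
noncomputable def colWeight (K : Matrix m n ℝ) (α δ : ℝ) (j : n) : ℝ :=
  δ + ∑ i, |K i j| ^ (2 - α)

omit [Fintype m] in
/-- Unfolding lemma for `rowWeight`. [cite: MaEtAl2023, Proposition 2 (M₂)] -/
theorem rowWeight_def (K : Matrix m n ℝ) (α δ : ℝ) (i : m) :
    rowWeight K α δ i = δ + ∑ j, |K i j| ^ α := rfl

omit [Fintype n] in
/-- Unfolding lemma for `colWeight`. [cite: MaEtAl2023, Proposition 2 (M₁)] -/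
theorem colWeight_def (K : Matrix m n ℝ) (α δ : ℝ) (j : n) :
    colWeight K α δ j = δ + ∑ i, |K i j| ^ (2 - α) := rfl

omit [Fintype m] in
/-- The weights are nonnegative for `δ ≥ 0`. [cite: MaEtAl2023, Proposition 2 («δ ≥ 0 is chosen such that τ_j, σ_i are positive»)] -/
theorem rowWeight_nonneg (K : Matrix m n ℝ) (α : ℝ) {δ : ℝ} (hδ : 0 ≤ δ) (i : m) :
    0 ≤ rowWeight K α δ i :=
  add_nonneg hδ (sum_nonneg fun _ _ => Real.rpow_nonneg (abs_nonneg _) _)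

omit [Fintype n] in
/-- The weights are nonnegative for `δ ≥ 0`. [cite: MaEtAl2023, Proposition 2 («δ ≥ 0 is chosen such that τ_j, σ_i are positive»)] -/
theorem colWeight_nonneg (K : Matrix m n ℝ) (α : ℝ) {δ : ℝ} (hδ : 0 ≤ δ) (j : n) :
    0 ≤ colWeight K α δ j :=
  add_nonneg hδ (sum_nonneg fun _ _ => Real.rpow_nonneg (abs_nonneg _) _)

/-- The splitting `|k|^α · |k|^{2−α} = k²` behind the Cauchy–Schwarz step (valid for every real `α`,
also at `k = 0`). [folklore: real powers] -/
private theorem rpow_mul_rpow_two_sub (k α : ℝ) : |k| ^ α * |k| ^ (2 - α) = k ^ 2 := by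
  rw [← Real.rpow_add' (abs_nonneg k) (by ring_nf; norm_num), show α + (2 - α) = (2 : ℝ) by ring,
    Real.rpow_two, sq_abs]

/-- **Pock–Chambolle's diagonal preconditioner lemma, weighted Cauchy–Schwarz form.** For every real
matrix `K`, every real `α`, every `δ ≥ 0` and all vectors `x`, `y`:
`⟨y, K x⟩² ≤ (Σ_i σ̂_i y_i²) · (Σ_j τ̂_j x_j²)`, `σ̂_i = δ + Σ_j |K_ij|^α`, `τ̂_j = δ + Σ_i |K_ij|^{2−α}`
— i.e. `|⟨y, Kx⟩| ≤ ‖y‖_{M₂} ‖x‖_{M₁}`, the basis-free content of `‖M₂^{−1/2} K M₁^{−1/2}‖ ≤ 1`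
(equivalently `‖Σ^{1/2} K T^{1/2}‖ ≤ 1` for the steps `T = M₁^{−1}`, `Σ = M₂^{−1}`). Proof: Cauchy–Schwarz
over the index pairs `(i, j)` with `(y_i K_ij x_j)² = (y_i² |K_ij|^α)(|K_ij|^{2−α} x_j²)`.
[cite: PockChambolle2011, Lemma 2] [cite: MaEtAl2023, Proposition 2 (proof, γ₁ = γ₂ = 1)] -/
theorem dotProduct_mulVec_sq_le (K : Matrix m n ℝ) (α : ℝ) {δ : ℝ} (hδ : 0 ≤ δ) (x : n → ℝ)
    (y : m → ℝ) :
    (y ⬝ᵥ (K *ᵥ x)) ^ 2 ≤ (∑ i, rowWeight K α δ i * y i ^ 2) * ∑ j, colWeight K α δ j * x j ^ 2 := by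
  classical
  -- `⟨y, Kx⟩` as a sum over pairs
  have hsum : y ⬝ᵥ (K *ᵥ x) = ∑ p : m × n, y p.1 * K p.1 p.2 * x p.2 := by
    simp only [dotProduct, mulVec, Finset.mul_sum, Fintype.sum_prod_type]
    exact Finset.sum_congr rfl fun i _ => Finset.sum_congr rfl fun j _ => by ring
  -- Cauchy–Schwarz over pairs with `f = y_i² |K_ij|^α`, `g = |K_ij|^{2−α} x_j²`
  have hcs : (∑ p : m × n, y p.1 * K p.1 p.2 * x p.2) ^ 2 ≤
      (∑ p : m × n, y p.1 ^ 2 * |K p.1 p.2| ^ α) * ∑ p : m × n, |K p.1 p.2| ^ (2 - α) * x p.2 ^ 2 :=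
    Finset.sum_sq_le_sum_mul_sum_of_sq_le_mul _
      (fun p _ => mul_nonneg (sq_nonneg _) (Real.rpow_nonneg (abs_nonneg _) _))
      (fun p _ => mul_nonneg (Real.rpow_nonneg (abs_nonneg _) _) (sq_nonneg _))
      (fun p _ => by
        have h := rpow_mul_rpow_two_sub (K p.1 p.2) α
        have e : y p.1 ^ 2 * |K p.1 p.2| ^ α * (|K p.1 p.2| ^ (2 - α) * x p.2 ^ 2) =
            y p.1 ^ 2 * (|K p.1 p.2| ^ α * |K p.1 p.2| ^ (2 - α)) * x p.2 ^ 2 := by ring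
        rw [e, h]
        exact le_of_eq (by ring))
  -- the two factors are bounded by the weighted squares (dropping `δ ≥ 0` terms is an inequality)
  have hf : ∑ p : m × n, y p.1 ^ 2 * |K p.1 p.2| ^ α ≤ ∑ i, rowWeight K α δ i * y i ^ 2 := by
    have e : ∑ p : m × n, y p.1 ^ 2 * |K p.1 p.2| ^ α = ∑ i, y i ^ 2 * ∑ j, |K i j| ^ α := by
      simp only [Fintype.sum_prod_type, Finset.mul_sum]
    rw [e]
    refine Finset.sum_le_sum fun i _ => ?_
    have h0 := mul_nonneg hδ (sq_nonneg (y i))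
    have e2 : rowWeight K α δ i * y i ^ 2 - y i ^ 2 * ∑ j, |K i j| ^ α = δ * y i ^ 2 := by
      rw [rowWeight]; ring
    linarith
  have hg : ∑ p : m × n, |K p.1 p.2| ^ (2 - α) * x p.2 ^ 2 ≤ ∑ j, colWeight K α δ j * x j ^ 2 := by
    have e : ∑ p : m × n, |K p.1 p.2| ^ (2 - α) * x p.2 ^ 2 =
        ∑ j, (∑ i, |K i j| ^ (2 - α)) * x j ^ 2 := by
      simp only [Fintype.sum_prod_type, Finset.sum_mul]
      rw [Finset.sum_comm]
    rw [e]
    refine Finset.sum_le_sum fun j _ => ?_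
    have h0 := mul_nonneg hδ (sq_nonneg (x j))
    have e2 : colWeight K α δ j * x j ^ 2 - (∑ i, |K i j| ^ (2 - α)) * x j ^ 2 = δ * x j ^ 2 := by
      rw [colWeight]; ring
    linarith
  have hf0 : 0 ≤ ∑ p : m × n, y p.1 ^ 2 * |K p.1 p.2| ^ α :=
    Finset.sum_nonneg fun p _ => mul_nonneg (sq_nonneg _) (Real.rpow_nonneg (abs_nonneg _) _)
  have hg0 : 0 ≤ ∑ p : m × n, |K p.1 p.2| ^ (2 - α) * x p.2 ^ 2 :=
    Finset.sum_nonneg fun p _ => mul_nonneg (Real.rpow_nonneg (abs_nonneg _) _) (sq_nonneg _)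
  rw [hsum]
  exact hcs.trans (mul_le_mul hf hg hg0 (hf0.trans hf))

/-- The rescaled coupling matrix `K̃ = M₂^{−1/2} K M₁^{−1/2}`, entrywise
`K̃_ij = K_ij / (√σ̂_i · √τ̂_j)`. [cite: MaEtAl2023, §1 (condition (PC1), ‖M₂^{−1/2} K M₁^{−1/2}‖ < 1) and Proposition 2] -/
noncomputable def rescaled (K : Matrix m n ℝ) (α δ : ℝ) : Matrix m n ℝ :=
  fun i j => K i j / (Real.sqrt (rowWeight K α δ i) * Real.sqrt (colWeight K α δ j))

/-- Unfolding lemma for `rescaled`. [cite: MaEtAl2023, §1 (condition (PC1)) and Proposition 2] -/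
theorem rescaled_apply (K : Matrix m n ℝ) (α δ : ℝ) (i : m) (j : n) :
    rescaled K α δ i j = K i j / (Real.sqrt (rowWeight K α δ i) * Real.sqrt (colWeight K α δ j)) :=
  rfl

/-- The rescaled matrix satisfies the unweighted Cauchy–Schwarz bound:
`⟨v, K̃ x⟩² ≤ ‖v‖₂² ‖x‖₂²` (positive weights) — `dotProduct_mulVec_sq_le` after the substitution
`y = M₂^{−1/2} v`, `x ↦ M₁^{−1/2} x`. [cite: PockChambolle2011, Lemma 2] [cite: MaEtAl2023, Proposition 2 (γ₁ = γ₂ = 1)] -/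
theorem dotProduct_rescaled_mulVec_sq_le (K : Matrix m n ℝ) (α : ℝ) {δ : ℝ} (hδ : 0 ≤ δ)
    (hrow : ∀ i, 0 < rowWeight K α δ i) (hcol : ∀ j, 0 < colWeight K α δ j) (x : n → ℝ)
    (v : m → ℝ) :
    (v ⬝ᵥ (rescaled K α δ *ᵥ x)) ^ 2 ≤ (∑ i, v i ^ 2) * ∑ j, x j ^ 2 := by
  classical
  set y : m → ℝ := fun i => v i / Real.sqrt (rowWeight K α δ i) with hy
  set x' : n → ℝ := fun j => x j / Real.sqrt (colWeight K α δ j) with hx'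
  have hsr : ∀ i, Real.sqrt (rowWeight K α δ i) ≠ 0 := fun i =>
    (Real.sqrt_pos.mpr (hrow i)).ne'
  have hsc : ∀ j, Real.sqrt (colWeight K α δ j) ≠ 0 := fun j =>
    (Real.sqrt_pos.mpr (hcol j)).ne'
  have h1 : y ⬝ᵥ (K *ᵥ x') = v ⬝ᵥ (rescaled K α δ *ᵥ x) := by
    simp only [dotProduct, mulVec, rescaled, hy, hx', Finset.mul_sum]
    refine Finset.sum_congr rfl fun i _ => Finset.sum_congr rfl fun j _ => ?_
    have ha := hsr i
    have hb := hsc j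
    field_simp
  have h2 : ∑ i, rowWeight K α δ i * y i ^ 2 = ∑ i, v i ^ 2 := by
    refine Finset.sum_congr rfl fun i _ => ?_
    simp only [hy]
    rw [div_pow, Real.sq_sqrt (hrow i).le, ← mul_div_assoc, mul_div_cancel_left₀ _ (hrow i).ne']
  have h3 : ∑ j, colWeight K α δ j * x' j ^ 2 = ∑ j, x j ^ 2 := by
    refine Finset.sum_congr rfl fun j _ => ?_
    simp only [hx']
    rw [div_pow, Real.sq_sqrt (hcol j).le, ← mul_div_assoc, mul_div_cancel_left₀ _ (hcol j).ne']
  have hcs := dotProduct_mulVec_sq_le K α hδ x' y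
  rw [h1, h2, h3] at hcs
  exact hcs

/-- **`‖M₂^{−1/2} K M₁^{−1/2}‖₂ ≤ 1`, squared-norm form.** If all weights are positive (e.g. `δ > 0`, or
`δ = 0` and `K` has no zero row or column) then the rescaled matrix is a Euclidean contraction:
`Σ_i (K̃ x)_i² ≤ Σ_j x_j²` for every `x` (take `v = K̃ x` in `dotProduct_rescaled_mulVec_sq_le`:
`‖K̃x‖⁴ ≤ ‖K̃x‖² ‖x‖²`). Hence preconditioned PDHG with the diagonal steps `T = M₁^{−1}`, `Σ = M₂^{−1}`
is plain PDHG with unit steps on a coupling matrix of norm `≤ 1`.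
[cite: PockChambolle2011, Lemma 2] [cite: MaEtAl2023, Proposition 2 (γ₁ = γ₂ = 1, Remark 5)] -/
theorem sum_sq_rescaled_mulVec_le (K : Matrix m n ℝ) (α : ℝ) {δ : ℝ} (hδ : 0 ≤ δ)
    (hrow : ∀ i, 0 < rowWeight K α δ i) (hcol : ∀ j, 0 < colWeight K α δ j) (x : n → ℝ) :
    ∑ i, (rescaled K α δ *ᵥ x) i ^ 2 ≤ ∑ j, x j ^ 2 := by
  set u : m → ℝ := rescaled K α δ *ᵥ x with hu
  have hcs := dotProduct_rescaled_mulVec_sq_le K α hδ hrow hcol x u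
  have hS : u ⬝ᵥ u = ∑ i, u i ^ 2 := by
    simp only [dotProduct, sq]
  rw [hS] at hcs
  have hnn : 0 ≤ ∑ i, u i ^ 2 := Finset.sum_nonneg fun _ _ => sq_nonneg _
  rcases hnn.lt_or_eq with hpos | hzero
  · exact le_of_mul_le_mul_left (by nlinarith [hcs]) hpos
  · rw [← hzero]
    exact Finset.sum_nonneg fun _ _ => sq_nonneg _

/-! #### The case `α = 1` (row and column `ℓ¹` norms — the default "Pock–Chambolle rescaling" of
PDLP-type codes) -/

omit [Fintype m] in
/-- For `α = 1` the dual weight is the row `ℓ¹` norm (plus `δ`): `σ̂_i = δ + Σ_j |K_ij|`.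
[cite: MaEtAl2023, Proposition 2 (α = 1)] [cite: PockChambolle2011, §2 eq. (10) with α = 1] -/
theorem rowWeight_one (K : Matrix m n ℝ) (δ : ℝ) (i : m) :
    rowWeight K 1 δ i = δ + ∑ j, |K i j| := by
  simp only [rowWeight, Real.rpow_one]

omit [Fintype n] in
/-- For `α = 1` the primal weight is the column `ℓ¹` norm (plus `δ`): `τ̂_j = δ + Σ_i |K_ij|`.
[cite: MaEtAl2023, Proposition 2 (α = 1)] [cite: PockChambolle2011, §2 eq. (10) with α = 1] -/
theorem colWeight_one (K : Matrix m n ℝ) (δ : ℝ) (j : n) :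
    colWeight K 1 δ j = δ + ∑ i, |K i j| := by
  simp only [colWeight, show (2 : ℝ) - 1 = 1 by norm_num, Real.rpow_one]

/-- The `α = 1` instance of the weighted Cauchy–Schwarz bound:
`⟨y, Kx⟩² ≤ (Σ_i (δ + ‖K_{i·}‖₁) y_i²)(Σ_j (δ + ‖K_{·j}‖₁) x_j²)`.
[cite: PockChambolle2011, Lemma 2 (α = 1)] [cite: MaEtAl2023, Proposition 2 (α = 1, γ₁ = γ₂ = 1)] -/
theorem dotProduct_mulVec_sq_le_one (K : Matrix m n ℝ) {δ : ℝ} (hδ : 0 ≤ δ) (x : n → ℝ)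
    (y : m → ℝ) :
    (y ⬝ᵥ (K *ᵥ x)) ^ 2 ≤
      (∑ i, (δ + ∑ j, |K i j|) * y i ^ 2) * ∑ j, (δ + ∑ i, |K i j|) * x j ^ 2 := by
  have h := dotProduct_mulVec_sq_le K 1 hδ x y
  simp only [rowWeight_one, colWeight_one] at h
  exact h

/-! #### The rescaled matrix as an operator between Euclidean spaces: `‖K̃‖ ≤ 1` -/

section Operator

variable [DecidableEq n]

/-- The rescaled coupling matrix `K̃ = M₂^{−1/2} K M₁^{−1/2}` as a continuous linear map
`ℝⁿ → ℝᵐ` between Euclidean spaces (the `K` to which plain PDHG with unit steps is applied after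
diagonal preconditioning). [cite: MaEtAl2023, §1 (condition (PC1)) and Proposition 2] -/
noncomputable def rescaledCLM (K : Matrix m n ℝ) (α δ : ℝ) :
    EuclideanSpace ℝ n →L[ℝ] EuclideanSpace ℝ m :=
  LinearMap.toContinuousLinearMap (Matrix.toEuclideanLin (rescaled K α δ))

/-- Unfolding lemma for `rescaledCLM`. [cite: MaEtAl2023, §1 (condition (PC1))] -/
theorem rescaledCLM_apply (K : Matrix m n ℝ) (α δ : ℝ) (x : EuclideanSpace ℝ n) :
    rescaledCLM K α δ x = WithLp.toLp 2 (rescaled K α δ *ᵥ WithLp.ofLp x) := rfl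

/-- **`‖M₂^{−1/2} K M₁^{−1/2}‖ ≤ 1` as an operator-norm statement** (positive weights): the rescaled
coupling operator between Euclidean spaces has norm at most `1`, so unit step sizes `τ = σ = 1`
satisfy `τσ‖K̃‖² ≤ 1` (and any `η < 1` gives `< 1`), the hypotheses of the PDHG theorems in
`PrimalDualHybridGradient.lean`. [cite: PockChambolle2011, Lemma 2] [cite: MaEtAl2023, Proposition 2 (γ₁ = γ₂ = 1, Remark 5)] -/
theorem norm_rescaledCLM_le_one (K : Matrix m n ℝ) (α : ℝ) {δ : ℝ} (hδ : 0 ≤ δ)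
    (hrow : ∀ i, 0 < rowWeight K α δ i) (hcol : ∀ j, 0 < colWeight K α δ j) :
    ‖rescaledCLM K α δ‖ ≤ 1 := by
  refine ContinuousLinearMap.opNorm_le_bound _ zero_le_one fun x => ?_
  rw [one_mul]
  have h := sum_sq_rescaled_mulVec_le K α hδ hrow hcol (WithLp.ofLp x)
  have hAx : ‖rescaledCLM K α δ x‖ ^ 2 = ∑ i, (rescaled K α δ *ᵥ WithLp.ofLp x) i ^ 2 := by
    rw [EuclideanSpace.real_norm_sq_eq]
    rfl
  have hx : ‖x‖ ^ 2 = ∑ j, (WithLp.ofLp x) j ^ 2 := by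
    rw [EuclideanSpace.real_norm_sq_eq]
  rw [← hAx, ← hx] at h
  exact (pow_le_pow_iff_left₀ (norm_nonneg _) (norm_nonneg _) two_ne_zero).mp h

end Operator

end Literature.Analysis.Convex.DiagonalPreconditioningPDHG
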